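import Mathlib
import Summits.Ventures.PercRepro2.ZMeanProof

/-!
# Series reduction: an unmarked vertex of degree `2` is an edge (blind cell PercRepro2, night-1 g9;
NIGHT1-G9.md §8 — the first (HMF)-skeleton reduction lemma of S3.10 (G3))

Let `x` carry exactly the two edges `e₁ = {u, x}` and `e₂ = {x, v}`.  Adjoin the edge
`none = {u, v}` of weight `p e₁ · p e₂` and set the weights of `e₁`, `e₂` to `0` (`ends'`, `p'`):
the map `Φ ω` (new edge open iff both `e₁`, `e₂` are open, `e₁`, `e₂` closed, the rest unchanged)
pushes the product law forward onto the product law (`prob_series`: the fibre of a configuration of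
the reduced graph has the weight of that configuration), and for vertices other than `x` the
connections of `Φ ω` are those of `ω` (`conn_series`, by the closure lemma).  Hence, for marks
different from `x`, every mass of `HMFc` transports, the rows of `X̂` regroup (`W` and `W ∪ {x}`
onto `W`) and **`HMFc p ends = HMFc p' ends'`** (`HMFc_series`), so `HMF p ends ↔ HMF p' ends'`
(`HMF_series_iff`): the path `u – x – v` through an unmarked vertex is the edge `u – v` of weight
`p e₁ · p e₂`, with `x` left isolated.
-/

namespace Summit.Ventures.PercRepro2

open UnionCluster CovForm

namespace SeriesEdge

section Defs

variable {V : Type*} {E : Type*} [DecidableEq E]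

/-- The graph with the edge `{u, v}` adjoined (the old edges keep their endpoints). -/
def ends' (ends : E → Sym2 V) (u v : V) : Option E → Sym2 V := fun e => e.elim s(u, v) ends

/-- The reduced weights: `p e₁ · p e₂` on the new edge, `0` on `e₁` and `e₂`. -/
def p' {R : Type*} [Mul R] [Zero R] (p : E → R) (e₁ e₂ : E) : Option E → R :=
  fun e => e.elim (p e₁ * p e₂) (fun e => if e = e₁ ∨ e = e₂ then 0 else p e)

/-- The pushforward of a configuration: the new edge is open iff `e₁` and `e₂` are, `e₁` and `e₂`
are closed, the other edges keep their states. -/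
def Φ (e₁ e₂ : E) (ω : Config E) : Config (Option E) :=
  fun e => e.elim (ω e₁ && ω e₂) (fun e => if e = e₁ ∨ e = e₂ then false else ω e)

omit [DecidableEq E] in
/-- The new edge. -/
@[simp] lemma ends'_none (ends : E → Sym2 V) (u v : V) : ends' ends u v none = s(u, v) := rfl
omit [DecidableEq E] in
/-- The old edges. -/
@[simp] lemma ends'_some (ends : E → Sym2 V) (u v : V) (e : E) : ends' ends u v (some e) = ends e :=
  rfl
/-- The new edge's weight. -/
@[simp] lemma p'_none {R : Type*} [Mul R] [Zero R] (p : E → R) (e₁ e₂ : E) :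
    p' p e₁ e₂ none = p e₁ * p e₂ := rfl
/-- The old edges' weights. -/
lemma p'_some {R : Type*} [Mul R] [Zero R] (p : E → R) (e₁ e₂ e : E) :
    p' p e₁ e₂ (some e) = if e = e₁ ∨ e = e₂ then 0 else p e := rfl
/-- The new edge's state. -/
@[simp] lemma Φ_none (e₁ e₂ : E) (ω : Config E) : Φ e₁ e₂ ω none = (ω e₁ && ω e₂) := rfl
/-- The old edges' states. -/
lemma Φ_some (e₁ e₂ : E) (ω : Config E) (e : E) :
    Φ e₁ e₂ ω (some e) = if e = e₁ ∨ e = e₂ then false else ω e := rfl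

end Defs

section Prob

variable {E : Type*} [Fintype E] [DecidableEq E] {R : Type*} [CommRing R]

/-- The weight of a configuration with `e₁`, `e₂` closed, split off the two edges. -/
lemma weight_split (p : E → R) {e₁ e₂ : E} (hne : e₁ ≠ e₂) (ω : Config E) (b₁ b₂ : Bool) :
    weight p (Function.update (Function.update ω e₁ b₁) e₂ b₂) =
      edgeFactor (p e₁) b₁ * edgeFactor (p e₂) b₂ *
        ∏ e ∈ (Finset.univ.erase e₁).erase e₂, edgeFactor (p e) (ω e) := by
  unfold weight
  rw [← Finset.mul_prod_erase Finset.univ _ (Finset.mem_univ e₂),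
    ← Finset.mul_prod_erase (Finset.univ.erase e₂) _ (Finset.mem_erase.2 ⟨hne, Finset.mem_univ e₁⟩)]
  have h1 : Function.update (Function.update ω e₁ b₁) e₂ b₂ e₂ = b₂ := Function.update_self _ _ _
  have h2 : Function.update (Function.update ω e₁ b₁) e₂ b₂ e₁ = b₁ := by
    rw [Function.update_of_ne hne, Function.update_self]
  rw [h1, h2, Finset.erase_right_comm]
  have h3 : ∏ e ∈ (Finset.univ.erase e₁).erase e₂,
      edgeFactor (p e) (Function.update (Function.update ω e₁ b₁) e₂ b₂ e) =
      ∏ e ∈ (Finset.univ.erase e₁).erase e₂, edgeFactor (p e) (ω e) := by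
    refine Finset.prod_congr rfl fun e he => ?_
    have he2 : e ≠ e₂ := (Finset.mem_erase.1 he).1
    have he1 : e ≠ e₁ := (Finset.mem_erase.1 (Finset.mem_erase.1 he).2).1
    rw [Function.update_of_ne he2, Function.update_of_ne he1]
  rw [h3]
  ring

/-- The weight of a configuration of the reduced graph with `e₁`, `e₂` closed. -/
lemma weight_p' (p : E → R) {e₁ e₂ : E} (hne : e₁ ≠ e₂) (ω' : Config (Option E))
    (h1 : ω' (some e₁) = false) (h2 : ω' (some e₂) = false) :
    weight (p' p e₁ e₂) ω' =
      edgeFactor (p e₁ * p e₂) (ω' none) *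
        ∏ e ∈ (Finset.univ.erase e₁).erase e₂, edgeFactor (p e) (ω' (some e)) := by
  unfold weight
  rw [Fintype.prod_option, p'_none]
  congr 1
  rw [← Finset.mul_prod_erase Finset.univ _ (Finset.mem_univ e₂),
    ← Finset.mul_prod_erase (Finset.univ.erase e₂) _ (Finset.mem_erase.2 ⟨hne, Finset.mem_univ e₁⟩)]
  rw [h1, h2, p'_some, p'_some, if_pos (Or.inr rfl), if_pos (Or.inl rfl), Finset.erase_right_comm]
  have h3 : ∏ e ∈ (Finset.univ.erase e₁).erase e₂, edgeFactor (p' p e₁ e₂ (some e)) (ω' (some e)) =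
      ∏ e ∈ (Finset.univ.erase e₁).erase e₂, edgeFactor (p e) (ω' (some e)) := by
    refine Finset.prod_congr rfl fun e he => ?_
    have he2 : e ≠ e₂ := (Finset.mem_erase.1 he).1
    have he1 : e ≠ e₁ := (Finset.mem_erase.1 (Finset.mem_erase.1 he).2).1
    rw [p'_some, if_neg (by rintro (h | h) <;> contradiction)]
  rw [h3]
  simp [edgeFactor]

/-- A configuration of the reduced graph with `e₁` or `e₂` open has weight `0`. -/
lemma weight_p'_eq_zero (p : E → R) (e₁ e₂ : E) (ω' : Config (Option E))
    (h : ω' (some e₁) = true ∨ ω' (some e₂) = true) : weight (p' p e₁ e₂) ω' = 0 := by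
  rcases h with h | h
  · rw [weight_eq_mul_edgeFactor _ ω' (some e₁), h, p'_some, if_pos (Or.inl rfl)]
    simp [edgeFactor]
  · rw [weight_eq_mul_edgeFactor _ ω' (some e₂), h, p'_some, if_pos (Or.inr rfl)]
    simp [edgeFactor]

/-- The fibre of `Φ` over a configuration with `e₁`, `e₂` closed. -/
lemma fiber_eq {e₁ e₂ : E} (hne : e₁ ≠ e₂) (ω' : Config (Option E))
    (h1 : ω' (some e₁) = false) (h2 : ω' (some e₂) = false) :
    (Finset.univ.filter fun ω : Config E => Φ e₁ e₂ ω = ω') =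
      ((Finset.univ : Finset (Bool × Bool)).filter fun bb => (bb.1 && bb.2) = ω' none).image
        (fun bb => Function.update (Function.update (fun e => ω' (some e)) e₁ bb.1) e₂ bb.2) := by
  ext ω
  simp only [Finset.mem_filter, Finset.mem_univ, true_and, Finset.mem_image]
  constructor
  · intro hΦ
    refine ⟨(ω e₁, ω e₂), ?_, ?_⟩
    · show (ω e₁ && ω e₂) = ω' none
      rw [← hΦ]; rfl
    · funext e
      by_cases he2 : e = e₂
      · subst he2; simp
      · rw [Function.update_of_ne he2]
        by_cases he1 : e = e₁
        · subst he1; simp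
        · rw [Function.update_of_ne he1, ← hΦ, Φ_some, if_neg (by rintro (h | h) <;> contradiction)]
  · rintro ⟨⟨b₁, b₂⟩, hb, rfl⟩
    simp only at hb
    funext e
    cases e with
    | none =>
      rw [Φ_none, Function.update_self, Function.update_of_ne hne, Function.update_self]
      exact hb
    | some e =>
      rw [Φ_some]
      by_cases h : e = e₁ ∨ e = e₂
      · rw [if_pos h]
        rcases h with rfl | rfl
        · exact h1.symm
        · exact h2.symm
      · push Not at h
        rw [if_neg (by rintro (h' | h') <;> [exact h.1 h'; exact h.2 h']),
          Function.update_of_ne h.2, Function.update_of_ne h.1]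

/-- **The pushforward identity**: `P_{p'}(A') = P_p(Φ ⁻¹' A')`. -/
theorem prob_series (p : E → R) {e₁ e₂ : E} (hne : e₁ ≠ e₂) (A' : Set (Config (Option E))) :
    prob (p' p e₁ e₂) A' = prob p (Φ e₁ e₂ ⁻¹' A') := by
  classical
  unfold prob
  conv_rhs => rw [← Finset.sum_fiberwise Finset.univ (Φ e₁ e₂)]
  refine Finset.sum_congr rfl fun ω' _ => ?_
  have hind : ∀ ω ∈ Finset.univ.filter (fun ω : Config E => Φ e₁ e₂ ω = ω'),
      (Φ e₁ e₂ ⁻¹' A').indicator (weight p) ω = A'.indicator (fun _ => weight p ω) ω' := by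
    intro ω hω
    have h := (Finset.mem_filter.1 hω).2
    rw [Set.indicator_apply, Set.indicator_apply, Set.mem_preimage, h]
  rw [Finset.sum_congr rfl hind]
  by_cases hopen : ω' (some e₁) = true ∨ ω' (some e₂) = true
  · -- empty fibre, zero weight
    have hempty : (Finset.univ.filter fun ω : Config E => Φ e₁ e₂ ω = ω') = ∅ := by
      rw [Finset.filter_eq_empty_iff]
      intro ω _ hΦ
      have h1 : Φ e₁ e₂ ω (some e₁) = false := by rw [Φ_some, if_pos (Or.inl rfl)]
      have h2 : Φ e₁ e₂ ω (some e₂) = false := by rw [Φ_some, if_pos (Or.inr rfl)]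
      rw [hΦ] at h1 h2
      rcases hopen with h | h
      · rw [h] at h1; exact absurd h1 (by decide)
      · rw [h] at h2; exact absurd h2 (by decide)
    rw [hempty, Finset.sum_empty, Set.indicator_apply]
    split_ifs
    · exact weight_p'_eq_zero p e₁ e₂ ω' hopen
    · rfl
  · push Not at hopen
    have h1 : ω' (some e₁) = false := Bool.eq_false_iff.2 hopen.1
    have h2 : ω' (some e₂) = false := Bool.eq_false_iff.2 hopen.2
    have hinj : Set.InjOn (fun bb : Bool × Bool =>
        Function.update (Function.update (fun e => ω' (some e)) e₁ bb.1) e₂ bb.2)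
        ↑((Finset.univ : Finset (Bool × Bool)).filter fun bb => (bb.1 && bb.2) = ω' none) := by
      intro a _ b _ hab
      have ha1 := congrFun hab e₁
      have ha2 := congrFun hab e₂
      simp only [Function.update_of_ne hne, Function.update_self] at ha1 ha2
      exact Prod.ext ha1 ha2
    by_cases hA : ω' ∈ A'
    · simp only [Set.indicator_of_mem hA]
      rw [fiber_eq hne ω' h1 h2, Finset.sum_image hinj, weight_p' p hne ω' h1 h2]
      simp only [weight_split p hne]
      rw [Finset.sum_filter]
      simp only [Fintype.sum_prod_type, Fintype.sum_bool]
      cases hn : ω' none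
      · simp [edgeFactor]; ring
      · simp [edgeFactor]
    · simp only [Set.indicator_of_notMem hA, Finset.sum_const_zero]

end Prob

section Conn

variable {V : Type*} {E : Type*} [DecidableEq E]

variable {ends : E → Sym2 V} {e₁ e₂ : E} {u v x : V}

/-- Open adjacency in `Φ ω`: either an old open edge other than `e₁`, `e₂`, or the new edge (both
`e₁`, `e₂` open) joining `u` and `v`. -/
lemma openAdj_Φ {ω : Config E} {a b : V} :
    OpenAdj (ends' ends u v) (Φ e₁ e₂ ω) a b ↔
      (∃ e, ω e = true ∧ ¬ (e = e₁ ∨ e = e₂) ∧ ends e = s(a, b)) ∨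
        (ω e₁ = true ∧ ω e₂ = true ∧ s(u, v) = s(a, b)) := by
  constructor
  · rintro ⟨e, he, hends⟩
    cases e with
    | none =>
      rw [Φ_none] at he
      exact Or.inr ⟨(Bool.and_eq_true_iff.1 he).1, (Bool.and_eq_true_iff.1 he).2, hends⟩
    | some e =>
      rw [Φ_some] at he
      by_cases h : e = e₁ ∨ e = e₂
      · rw [if_pos h] at he; exact absurd he (by decide)
      · rw [if_neg h] at he; exact Or.inl ⟨e, he, h, hends⟩
  · rintro (⟨e, he, h, hends⟩ | ⟨h1, h2, hends⟩)
    · exact ⟨some e, by rw [Φ_some, if_neg h]; exact he, hends⟩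
    · exact ⟨none, by rw [Φ_none, h1, h2]; rfl, hends⟩

variable (he₁ : ends e₁ = s(u, x)) (he₂ : ends e₂ = s(x, v)) (hx : ∀ e, x ∈ ends e → e = e₁ ∨ e = e₂)
  (hux : u ≠ x) (hvx : v ≠ x)
include he₁ he₂ hx

omit [DecidableEq E] in
/-- An edge not at `x` is neither `e₁` nor `e₂`. -/
lemma ne_of_not_mem {e : E} (h : x ∉ ends e) : ¬ (e = e₁ ∨ e = e₂) := by
  rintro (rfl | rfl)
  · exact h (he₁ ▸ Sym2.mem_mk_right _ _)
  · exact h (he₂ ▸ Sym2.mem_mk_left _ _)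

include hux hvx

/-- In `Φ ω` the vertex `x` is isolated: nothing other than `x` is connected to it. -/
lemma ne_x_of_conn {ω : Config E} {a y : V} (ha : a ≠ x)
    (h : Conn (ends' ends u v) (Φ e₁ e₂ ω) a y) : y ≠ x := by
  refine mem_of_conn_of_closed (S := {y | y ≠ x}) ?_ ha h
  intro y hy z hyz
  rw [openGraph_adj] at hyz
  rcases openAdj_Φ.1 hyz.2 with ⟨e, _, hne, hends⟩ | ⟨_, _, hends⟩
  · intro hzx
    subst hzx
    exact hne (hx e (hends ▸ Sym2.mem_mk_right _ _))
  · intro hzx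
    subst hzx
    rcases Sym2.eq_iff.1 hends with ⟨_, h'⟩ | ⟨h', _⟩
    · exact hvx h'
    · exact hux h'

/-- **Connections transport**: for `a, b ≠ x`, `a ↔ b` in `Φ ω` iff in `ω`. -/
theorem conn_series {ω : Config E} {a b : V} (ha : a ≠ x) (hb : b ≠ x) :
    Conn (ends' ends u v) (Φ e₁ e₂ ω) a b ↔ Conn ends ω a b := by
  constructor
  · -- the connections of `ω` are closed under the adjacencies of `Φ ω`
    intro h
    refine mem_of_conn_of_closed (S := {y | Conn ends ω a y}) ?_ (conn_refl ends ω a) h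
    intro y hy z hyz
    rw [openGraph_adj] at hyz
    rcases openAdj_Φ.1 hyz.2 with ⟨e, he, _, hends⟩ | ⟨h1, h2, hends⟩
    · exact conn_trans hy (conn_of_openAdj ⟨e, he, hends⟩)
    · have huv : Conn ends ω u v :=
        conn_trans (conn_of_openAdj ⟨e₁, h1, he₁⟩) (conn_of_openAdj ⟨e₂, h2, he₂⟩)
      rcases Sym2.eq_iff.1 hends with ⟨hu', hv'⟩ | ⟨hu', hv'⟩
      · show Conn ends ω a z
        rw [← hv']; exact conn_trans hy (hu' ▸ huv)
      · show Conn ends ω a z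
        rw [← hu']; exact conn_trans hy (hv' ▸ conn_symm huv)
  · -- the connections of `Φ ω`, with `x` added once reached, are closed under the adjacencies of `ω`
    intro h
    let C : V → Prop := fun y => Conn (ends' ends u v) (Φ e₁ e₂ ω) a y
    have hmem : b ∈ {y | C y ∨ (y = x ∧ ((C u ∧ ω e₁ = true) ∨ (C v ∧ ω e₂ = true)))} := by
      refine mem_of_conn_of_closed ?_ (Or.inl (conn_refl _ _ a)) h
      intro y hy z hyz
      rw [openGraph_adj] at hyz
      obtain ⟨_, e, he, hends⟩ := hyz
      rcases hy with hyC | ⟨hyx, hyx'⟩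
      · have hyne : y ≠ x := ne_x_of_conn he₁ he₂ hx hux hvx ha hyC
        by_cases hzx : z = x
        · rw [hzx] at hends
          rcases hx e (hends ▸ Sym2.mem_mk_right _ _) with rfl | rfl
          · have hyu : y = u := by
              rw [he₁] at hends
              rcases Sym2.eq_iff.1 hends with ⟨h', _⟩ | ⟨h', _⟩
              · exact h'.symm
              · exact absurd h' hux
            exact Or.inr ⟨hzx, Or.inl ⟨hyu ▸ hyC, he⟩⟩
          · have hyv : y = v := by
              rw [he₂] at hends
              rcases Sym2.eq_iff.1 hends with ⟨h', _⟩ | ⟨_, h'⟩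
              · exact absurd h'.symm hyne
              · exact h'.symm
            exact Or.inr ⟨hzx, Or.inr ⟨hyv ▸ hyC, he⟩⟩
        · have hnot : x ∉ ends e := by
            rw [hends]; intro hmem'
            rcases Sym2.mem_iff.1 hmem' with h' | h'
            · exact hyne h'.symm
            · exact hzx h'.symm
          exact Or.inl (conn_trans hyC (conn_of_openAdj (openAdj_Φ.2
            (Or.inl ⟨e, he, ne_of_not_mem he₁ he₂ hx hnot, hends⟩))))
      · rw [hyx] at hends
        rcases hx e (hends ▸ Sym2.mem_mk_left _ _) with rfl | rfl
        · have hzu : z = u := by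
            rw [he₁] at hends
            rcases Sym2.eq_iff.1 hends with ⟨h', _⟩ | ⟨h', _⟩
            · exact absurd h' hux
            · exact h'.symm
          rw [hzu]
          rcases hyx' with ⟨huC, _⟩ | ⟨hvC, h2⟩
          · exact Or.inl huC
          · exact Or.inl (conn_trans hvC (conn_of_openAdj (openAdj_Φ.2
              (Or.inr ⟨he, h2, Sym2.eq_swap⟩))))
        · have hzv : z = v := by
            rw [he₂] at hends
            rcases Sym2.eq_iff.1 hends with ⟨_, h'⟩ | ⟨_, h'⟩
            · exact h'.symm
            · exact absurd h' hvx
          rw [hzv]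
          rcases hyx' with ⟨huC, h1⟩ | ⟨hvC, _⟩
          · exact Or.inl (conn_trans huC (conn_of_openAdj (openAdj_Φ.2 (Or.inr ⟨h1, he, rfl⟩))))
          · exact Or.inl hvC
    rcases hmem with hb' | ⟨hbx, _⟩
    · exact hb'
    · exact absurd hbx hb

end Conn

end SeriesEdge

end Summit.Ventures.PercRepro2
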